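import Summits.BirchSwinnertonDyer.BirchSwinnertonDyer.Theorems.Rank1ResidualX1Converse
import Summits.BirchSwinnertonDyer.BirchSwinnertonDyer.Theorems.Rank1ResidualX1RankOneOddPrime
import Literature.NumberTheory.EllipticCurves.Rank1Residual.X1ThreeDescentCertificate

/-!
# Rank-≤1 BSD residual class X1: Mazur's main conjecture is an ISOGENY-CLASS statement on X1 ∩ {r ≤ 1},
# and every per-curve certificate of the cell proves it at every curve of the class

HONEST FRAMING (cell `b2b-bsdres`, home `run/shared/lean/b2b/bsd-rank1-residual/`, unit
`b2b-bsdres-x1b`, prover B = the independent patchwork, no Keller–Yin input, GEN 6). The goal is to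
DELETE the COMBINATION-SHAPED residual classes for ALL analytic-rank `≤ 1` curves over `ℚ` — "full BSD
formula for every rank `≤ 1` curve in class C" assembled STRICTLY from published theorems — so that the
rank-`≤ 1` remainder becomes exactly the CONSTRUCTION-SHAPED classes, which are TYPED (missing-input
`Prop`s), NOT attempted; this is not "finishing BSD". Helper file of the crux `PAdicOrderMainConjectureR5`
(stmt-BirchSwinnertonDyer-15418), in prover A's vocabulary (`MazurMainConjecture W p`,
`Rank1ResidualX1Defs`).

The typed residual of class X1 is Mazur's cyclotomic main conjecture at the anomalous Eisenstein pairs of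
type A (`MazurMainConjectureOnX1TypeA`; gens 2–4: `MazurMainConjecture W p ↔ BSDp W p` at every X1 pair
of analytic rank `≤ 1`, modulo the per-curve Schneider certificate at rank one). The lane counts ISOGENY
CLASSES (one optimal curve per class). This file records, from PUBLISHED theorems only, that the two
match: on X1 ∩ {r ≤ 1}

* `bsdp_iff_of_isIsogenous` — Miller's `BSD(E,p)` is invariant under `ℚ`-isogeny at analytic rank `≤ 1`
  (Cassels 1965 / Milne ADT I.7.3 `bsdRHS_eq_of_isIsogenous`, both directions, with GZK finiteness and
  modularity for the non-vanishing of the leading Taylor coefficient) — class-free;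
* `mazurMainConjecture_iff_of_isIsogenous_of_analyticRank_eq_zero` — at an X1 pair with `r_an = 0`,
  `MazurMainConjecture W p ↔ MazurMainConjecture W' p` for every globally minimal `W' ∼ W` (the class
  predicate transports by `ClassX1.of_isIsogenous`); in print this is the isogeny invariance of the main
  conjecture (Schneider / Perrin-Riou `μ`-formula, Wuthrich 2014 Lemma 17) — here it DROPS OUT of the
  kernel iff `MC ↔ BSDp` (Wuthrich Thm. 16 + Greenberg Thm. 4.1) and Cassels;
* `mazurMainConjecture_iff_of_isIsogenous_of_analyticRank_eq_one` — the same at `r_an = 1`, every `p` of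
  the class, modulo the Schneider certificate on BOTH curves (Wuthrich Thm. 16, Perrin-Riou–Schneider =
  BMS Thm. 1.7, Perrin-Riou 1987, Mazur–Tate `σ`, modularity, GZK);
* `mazurMainConjecture_of_bsdp_of_isIsogenous_of_analyticRank_eq_zero` /
  `mazurMainConjecture_of_noPTorsion_of_isIsogenous` — consequently EVERY per-curve certificate the cell
  computes on ANY curve `E'` of the class (rank `0`: `p ∤ #Ш(E')_an`, or the Cassels–Tate certificate;
  rank `1`: the explicit `p`-isogeny-descent certificate `Ш(E')[p] = 0` with `p ∤ #Ш(E')_an`, plus the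
  Schneider certificate of `E`) proves Mazur's main conjecture at `(E, p)` for every curve `E` of the
  class — e.g. at all `4` curves of `10406j`, `15059d` (rank `0`, `3 ∣ #Ш`), and at every curve of the
  `651 + 61` rank-one census classes carrying a descent certificate (prover B gen 5; one engine, the
  lane books).

Nothing here is a class theorem; no census verdict is changed; no new named fact (binders are the
cell's standing PUBLISHED facts). References: [Wuthrich2014] Thm. 16, Lemma 17, Prop. 21;
[GreenbergLNM1716] Thm. 4.1; [MilneADT2006] Thm. I.7.3; [PerrinRiou1987] §1.4; [Balakrishnan2016] §2;
[Miller2011LMS] Def. 1.1; [MillerStoll2012] §9 (explicit isogeny descent).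
-/

noncomputable section

open scoped Classical MatrixGroups ModularForm

open CongruenceSubgroup WeierstrassCurve Literature.NumberTheory.EllipticCurves
  Literature.NumberTheory.EllipticCurves.ModularForms Literature.NumberTheory.EllipticCurves.Rank1Residual
  Literature.NumberTheory.EllipticCurves.Rank1Residual.Typed
  Summit.BirchSwinnertonDyer.BirchSwinnertonDyer.Theorems.Rank1ResidualX1Defs
  Summit.BirchSwinnertonDyer.BirchSwinnertonDyer.Theorems.Rank1ResidualX1Converse
  Summit.BirchSwinnertonDyer.BirchSwinnertonDyer.Theorems.Rank1ResidualX1RankOneOddPrime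

set_option linter.dupNamespace false
set_option autoImplicit false

namespace Summit.BirchSwinnertonDyer.BirchSwinnertonDyer.Theorems.Rank1ResidualX1Isogeny

/-- **`BSD(E,p)` is a `ℚ`-isogeny-class statement at analytic rank `≤ 1`.** For globally minimal
`W ∼ W'` with `ord_{s=1} L(E,s) ≤ 1`: `BSDp W p ↔ BSDp W' p`, granted Gross–Zagier–Kolyvagin (`hGZK`,
finiteness of `Ш` on both sides), modularity (`hmod`, the leading Taylor coefficient is non-zero) and
Cassels' invariance of the BSD quotient (`hCassels`). Class-free.
[cite: MilneADT2006, Thm. I.7.3] [cite: Miller2011LMS, Def. 1.1] -/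
theorem bsdp_iff_of_isIsogenous (hGZK : rank_eq_analyticRank_of_analyticRank_le_one)
    (hmod : hasEntireLFunction_rat) (hCassels : bsdRHS_eq_of_isIsogenous)
    (W W' : WeierstrassCurve ℚ) [W.IsElliptic] [W'.IsElliptic] [W.IsGloballyMinimal]
    [W'.IsGloballyMinimal] (hiso : IsIsogenous W W') (p : ℕ) [Fact p.Prime]
    (hr : W.analyticRank ≤ 1) : BSDp W p ↔ BSDp W' p := by
  have hr' : W'.analyticRank ≤ 1 := by rwa [← analyticRank_eq_of_isIsogenous' hiso]
  obtain ⟨-, hfin⟩ := hGZK W hr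
  obtain ⟨-, hfin'⟩ := hGZK W' hr'
  have hlead : W.leadingLCoeff ≠ 0 := WeierstrassCurve.leadingLCoeff_ne_zero_holds (hmod W)
  have hlead' : W'.leadingLCoeff ≠ 0 := WeierstrassCurve.leadingLCoeff_ne_zero_holds (hmod W')
  exact ⟨fun h => Wuthrich2014.bsdp_of_isIsogenous hCassels hiso.symm_of_charZero hfin hlead h,
    fun h => Wuthrich2014.bsdp_of_isIsogenous hCassels hiso hfin' hlead' h⟩

/-- **Mazur's main conjecture is an isogeny-class statement on X1 ∩ {r = 0}.** At an X1 pair `(E, p)`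
with `ord_{s=1} L(E,s) = 0` and a globally minimal `W' ∼ W`: `MazurMainConjecture W p ↔
MazurMainConjecture W' p`, granted the PUBLISHED facts Wuthrich 2014 Thm. 16 (`hW16`), Greenberg 1999
Thm. 4.1 (`hGr`), modularity (`hmod`, `hmod'`), GZK (`hGZK`), Cassels (`hCassels`). Route: the kernel
iff `MazurMainConjecture ↔ BSDp` on both curves (`mazurMainConjecture_iff_bsdp`; `ClassX1 W' p` by
`ClassX1.of_isIsogenous`) and `bsdp_iff_of_isIsogenous`. (In print: Wuthrich 2014 Lemma 17.)
[cite: Wuthrich2014, Thm. 16 (p. 393) and Lemma 17] [cite: GreenbergLNM1716, Thm. 4.1]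
[cite: MilneADT2006, Thm. I.7.3] -/
theorem mazurMainConjecture_iff_of_isIsogenous_of_analyticRank_eq_zero
    (hW16 : Wuthrich2014.charIdeal_dvd_padicLFunction) (hGr : greenberg_charValue_rankZero)
    (hmod : nonempty_modularParametrizationData) (hmod' : hasEntireLFunction_rat)
    (hGZK : rank_eq_analyticRank_of_analyticRank_le_one) (hCassels : bsdRHS_eq_of_isIsogenous)
    (W W' : WeierstrassCurve ℚ) [W.IsElliptic] [W'.IsElliptic] [W.IsGloballyMinimal]
    [W'.IsGloballyMinimal] (hiso : IsIsogenous W W') (p : ℕ) [Fact p.Prime]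
    (hX1 : ClassX1 W p) (hr0 : W.analyticRank = 0) :
    MazurMainConjecture W p ↔ MazurMainConjecture W' p := by
  have hX1' : ClassX1 W' p := ClassX1.of_isIsogenous hiso hX1
  have hr0' : W'.analyticRank = 0 := by rw [← analyticRank_eq_of_isIsogenous' hiso]; exact hr0
  rw [mazurMainConjecture_iff_bsdp hW16 hGr hmod hGZK W p hX1 hr0,
    mazurMainConjecture_iff_bsdp hW16 hGr hmod hGZK W' p hX1' hr0']
  exact bsdp_iff_of_isIsogenous hGZK hmod' hCassels W W' hiso p (by omega)

/-- **Mazur's main conjecture is an isogeny-class statement on X1 ∩ {r = 1}, every `p` of the class,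
modulo the Schneider certificate on both curves.** At an X1 pair `(E, p)` with `ord_{s=1} L(E,s) = 1`
and a globally minimal `W' ∼ W`, granted the PUBLISHED facts Wuthrich 2014 Thm. 16 (`hW16`),
Perrin-Riou–Schneider = BMS 2016 Thm. 1.7 (`hS`), Perrin-Riou 1987 (`hPR`), the Mazur–Tate `σ`-function
(`hMT`), modularity (`hmod`, `hmod'`), GZK (`hGZK`), Cassels (`hCassels`), and the per-curve
non-degeneracy of the canonical `p`-adic height on `E` (`hSch`) and on `E'` (`hSch'`):
`MazurMainConjecture W p ↔ MazurMainConjecture W' p`.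
[cite: Wuthrich2014, Thm. 16 (p. 393), Lemma 17 and §6] [cite: PerrinRiou1987, §1.4 Cor. 1.8]
[cite: Balakrishnan2016, §2] [cite: MilneADT2006, Thm. I.7.3] -/
theorem mazurMainConjecture_iff_of_isIsogenous_of_analyticRank_eq_one
    (hW16 : Wuthrich2014.charIdeal_dvd_padicLFunction) (hS : Schneider1985_order_charGenerator_odd)
    (hPR : perrinRiou_rankOne_leadingTerms_odd) (hMT : mazur_tate_sigma_exists_odd)
    (hmod : nonempty_modularParametrizationData) (hmod' : hasEntireLFunction_rat)
    (hGZK : rank_eq_analyticRank_of_analyticRank_le_one) (hCassels : bsdRHS_eq_of_isIsogenous)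
    (W W' : WeierstrassCurve ℚ) [W.IsElliptic] [W'.IsElliptic] [W.IsGloballyMinimal]
    [W'.IsGloballyMinimal] (hiso : IsIsogenous W W') (p : ℕ) [Fact p.Prime]
    (hX1 : ClassX1 W p) (hr1 : W.analyticRank = 1)
    (hSch : ∀ Dh : PAdicHeightData W p, Dh.IsCanonical → SchneiderConjecture Dh)
    (hSch' : ∀ Dh : PAdicHeightData W' p, Dh.IsCanonical → SchneiderConjecture Dh) :
    MazurMainConjecture W p ↔ MazurMainConjecture W' p := by
  have hX1' : ClassX1 W' p := ClassX1.of_isIsogenous hiso hX1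
  have hr1' : W'.analyticRank = 1 := by rw [← analyticRank_eq_of_isIsogenous' hiso]; exact hr1
  rw [mazurMainConjecture_iff_bsdp_of_analyticRank_eq_one hW16 hS hPR hMT hmod hGZK W p hX1 hr1 hSch,
    mazurMainConjecture_iff_bsdp_of_analyticRank_eq_one hW16 hS hPR hMT hmod hGZK W' p hX1' hr1' hSch']
  exact bsdp_iff_of_isIsogenous hGZK hmod' hCassels W W' hiso p (by omega)

/-- **Any rank-`0` per-curve certificate on any curve of the class proves Mazur's MC at every curve of
the class**: at an X1 pair `(E, p)` with `ord_{s=1} L(E,s) = 0`, `BSDp W' p` for SOME globally minimal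
`W' ∼ W` implies `MazurMainConjecture W p` (same facts as
`mazurMainConjecture_iff_of_isIsogenous_of_analyticRank_eq_zero`). The cell's rank-`0` certificates
(`p ∤ #Ш(E')_an`: Wuthrich Prop. 21; the Cassels–Tate certificate `Ш(E')[p] ≠ 0` with
`ord_p #Ш(E')_an = 2`) all conclude `BSDp W' p`, so each is an instance.
[cite: Wuthrich2014, Thm. 16 (p. 393) and Prop. 21 (p. 400)] [cite: GreenbergLNM1716, Thm. 4.1] -/
theorem mazurMainConjecture_of_bsdp_of_isIsogenous_of_analyticRank_eq_zero
    (hW16 : Wuthrich2014.charIdeal_dvd_padicLFunction) (hGr : greenberg_charValue_rankZero)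
    (hmod : nonempty_modularParametrizationData) (hmod' : hasEntireLFunction_rat)
    (hGZK : rank_eq_analyticRank_of_analyticRank_le_one) (hCassels : bsdRHS_eq_of_isIsogenous)
    (W W' : WeierstrassCurve ℚ) [W.IsElliptic] [W'.IsElliptic] [W.IsGloballyMinimal]
    [W'.IsGloballyMinimal] (hiso : IsIsogenous W W') (p : ℕ) [Fact p.Prime]
    (hX1 : ClassX1 W p) (hr0 : W.analyticRank = 0) (hB' : BSDp W' p) : MazurMainConjecture W p :=
  (mazurMainConjecture_iff_bsdp hW16 hGr hmod hGZK W p hX1 hr0).mpr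
    ((bsdp_iff_of_isIsogenous hGZK hmod' hCassels W W' hiso p (by omega)).mpr hB')

/-- **The rank-one explicit-descent certificate on any curve of the class proves Mazur's MC at `(E, p)`**
(every `p` of the class). At an X1 pair `(E, p)` with `ord_{s=1} L(E,s) = 1`, a globally minimal
`W' ∼ W` with `p ∤ #Ш(E')_an` (`hq'`, `hv'`) and the finite algebraic certificate `Ш(E')[p] = 0` (`h'`,
e.g. from a complete explicit `p`-isogeny descent, Miller–Stoll, Math. Comp. 82 (2013) §9) give `BSDp W p`
(`X1.bsdp_of_noPTorsion_of_isIsogenous`: GZK + Cassels only); with the Schneider certificate of `E`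
(`hSch`) the kernel iff `MazurMainConjecture W p ↔ BSDp W p` then yields Mazur's main conjecture at
`(E, p)` — at type-A anomalous pairs, outside Greenberg–Vatsal 2000 and Castella–Grossi–Skinner 2025.
Per curve; NOT a class theorem. [cite: MillerStoll2012, §9] [cite: Wuthrich2014, Thm. 16 and §6]
[cite: PerrinRiou1987, §1.4 Cor. 1.8] [cite: Balakrishnan2016, §2] [cite: MilneADT2006, Thm. I.7.3] -/
theorem mazurMainConjecture_of_noPTorsion_of_isIsogenous
    (hW16 : Wuthrich2014.charIdeal_dvd_padicLFunction) (hS : Schneider1985_order_charGenerator_odd)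
    (hPR : perrinRiou_rankOne_leadingTerms_odd) (hMT : mazur_tate_sigma_exists_odd)
    (hmod : nonempty_modularParametrizationData) (hmod' : hasEntireLFunction_rat)
    (hGZK : rank_eq_analyticRank_of_analyticRank_le_one) (hCassels : bsdRHS_eq_of_isIsogenous)
    (W W' : WeierstrassCurve ℚ) [W.IsElliptic] [W'.IsElliptic] [W.IsGloballyMinimal]
    [W'.IsGloballyMinimal] (hiso : IsIsogenous W W') (p : ℕ) [Fact p.Prime]
    (hX1 : ClassX1 W p) (hr1 : W.analyticRank = 1)
    (hSch : ∀ Dh : PAdicHeightData W p, Dh.IsCanonical → SchneiderConjecture Dh)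
    {q' : ℚ} (hq' : shaAn W' = (q' : ℂ)) (hv' : padicValRat p q' = 0)
    (h' : ∀ x : W'.sha, (p : ℤ) • x = 0 → x = 0) : MazurMainConjecture W p :=
  (mazurMainConjecture_iff_bsdp_of_analyticRank_eq_one hW16 hS hPR hMT hmod hGZK W p hX1 hr1 hSch).mpr
    (X1.bsdp_of_noPTorsion_of_isIsogenous hGZK hmod' hCassels W W' hiso p (by omega) hX1 hq' hv' h')

end Summit.BirchSwinnertonDyer.BirchSwinnertonDyer.Theorems.Rank1ResidualX1Isogeny

end
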